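import Summits.BirchSwinnertonDyer.BirchSwinnertonDyer.Theorems.KolyvaginDepthDoorDepthTableKurihara
import Summits.BirchSwinnertonDyer.BirchSwinnertonDyer.Theorems.KolyvaginDepthDoorDepthTableIntrinsicSplit
import HarnessLib

/-!
# Route `KolyvaginDepthDoor`, crux `KolyvaginDepthSupplyKN` (stmt-BirchSwinnertonDyer-22820) —
# DEPTH TABLE v17, GENERIC (split cell): the crux's clause at `W` from TWO unit Kurihara numbers on the CASTELLA–SANO cell
# (`d_K` odd, `p` split in `K`; no ♠, any conductor)

Helper file of the lead prover of line `levelone` (kdd-p1 g21; `--supports stmt-BirchSwinnertonDyer-22820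
--as helper`); it closes nothing and BSD is NOT proved by it.

The split-cell twin of `cruxBody_of_kuriharaClaims_spade` (`KolyvaginDepthDoorDepthTableKurihara`): E-side `Ш(E)[p] = 0` and twist side
`#Sel_p(E^{(d_K)}) ≤ p^{ν(m)}` from two Kurihara claims exactly as there (Kim 2026 Thm. 1.11 by name), then the structure print of the
split cell — g20's `cruxBody_of_sha_of_twistSelmer_of_castellaSano` (Castella–Sano 2026 Thm. 3, Zanarella 2019 Prop. 2.18, Howard–Zanarella,
modularity, Mazur BY NAME) — instead of W. Zhang's Lemma 8.4 (1). Serves the non-♠ conductors of the table (`664a1`, `916c1`, `944e1`) and every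
rank-two curve at a prime split in its Heegner field, once a Kurihara record of the twist exists (CLOSING-DATA-v17.md in the crux dir).
CONDITIONAL; per `(W, p, K)`; nothing class-wide; BSD is NOT proved by it.

References: [Kim2022StructureSelmer] Thm. 1.11; [CastellaSano2026] Thm. 3 (arXiv:2601.14504 §1.1.6); [Zanarella2019] Prop. 2.18; [Howard2004]
Lemma 1.6.4; [Mazur1978] Cor. 4.1.
-/

set_option linter.dupNamespace false

noncomputable section

open scoped Classical NumberField

namespace Summit.BirchSwinnertonDyer.BirchSwinnertonDyer.Theorems.KolyvaginDepthDoor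

open Literature.NumberTheory.EllipticCurves Literature.NumberTheory.EllipticCurves.ModularForms
  WeierstrassCurve NumberField IsDedekindDomain
open Summit.BirchSwinnertonDyer.BirchSwinnertonDyer.Theorems

/-- **THE v17 ROW MECHANISM ON THE SPLIT CELL (Castella–Sano supply; `d_K` odd, `p` split in `K`; no ♠,
any conductor): the clause of `KolyvaginDepthSupplyKN` at `W` from TWO UNIT KURIHARA NUMBERS** — as
`cruxBody_of_kuriharaClaims_spade`, with the structure print of g20's `cruxBody_of_sha_of_twistSelmer_of_castellaSano`
(Castella–Sano Thm. 3, Zanarella 2.18, Howard–Zanarella BY NAME). CONDITIONAL; per `(W, p, K)`; nothing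
class-wide; BSD is not proved by it. [cite: Kim2022StructureSelmer, Thm. 1.11 (PDF p. 8)]
[cite: CastellaSano2026, Thm. 3 (arXiv:2601.14504 §1.1.6)] [cite: Zanarella2019, Prop. 2.18, Cor. 2.14] [cite: Howard2004, Lemma 1.6.4] -/
theorem cruxBody_of_kuriharaClaims_split
    (hKim : Kim2022_card_selmerGroup_le_pow_of_kuriharaNumber_ne_zero)
    (hnf : exists_isNewformOf) (hMaz : mazur_not_dvd_maninConstant_of_odd)
    (h3 : Literature.NumberTheory.EllipticCurves.CastellaSano2026_kolyvaginClass_selmerDivisibility_eq_padicValNat_tamagawaProduct)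
    (hZ : Literature.NumberTheory.EllipticCurves.Zanarella2019_kolyvaginClass_one_ne_zero_of_not_selmerDivisible)
    (hHZ : Literature.NumberTheory.EllipticCurves.HowardZanarella_exists_minimal_kolyvaginClass_one_selmerCard_of_ne_zero)
    (W : WeierstrassCurve ℚ) [W.IsElliptic] [W.IsGloballyMinimal] (hr : 2 ≤ W.mordellWeilRank)
    (p : ℕ) [hp : Fact p.Prime] (h5 : 5 ≤ p) (hgood : W.HasGoodReductionAtPrime p)
    (hord : ¬ (p : ℤ) ∣ W.frobeniusTrace p)
    (htower : ∀ n : ℕ, W.HasSurjectiveModNGaloisRep (p ^ n : ℕ))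
    (hKN : ∀ v : HeightOneSpectrum (𝓞 ℚ), W.HasMultiplicativeReductionAt v → ¬ p ∣ W.ordMinimalDiscriminant v)
    (hna : ¬ (p : ℤ) ∣ W.frobeniusTrace p - 1)
    (K : Type) [Field K] [NumberField K] (hK : IsImaginaryQuadratic K)
    (hodd : Odd (NumberField.discr K)) (hD3 : NumberField.discr K ≠ -3) (hD4 : NumberField.discr K ≠ -4)
    (hpD : ¬ ((p : ℤ) ∣ NumberField.discr K)) (hspl : SatisfiesHeegnerHypothesis p K)
    [iNZ : NeZero (W.conductorNorm ℤ)] (hH : SatisfiesHeegnerHypothesis (W.conductorNorm ℤ) K)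
    (n : ℕ) [NeZero n] (hn : IsCyclicKolyvaginLevel W p n) (hν : n.primeFactors.card ≤ W.mordellWeilRank)
    (hδ : ∀ (D : ModularParametrizationData W (W.conductorNorm ℤ)), ¬ (p : ℤ) ∣ D.maninConstant →
      (∃ u : ℚ, ‖(u : ℚ_[p])‖ = 1 ∧ W.realPeriodRat = u * plusPeriod D.f) →
      ∃ ψ : (ℓ : ℕ) → (ZMod ℓ)ˣ →* Multiplicative (ZMod p),
        (∀ ℓ ∈ n.primeFactors, Function.Surjective (ψ ℓ)) ∧ kuriharaNumber D.f p n ψ ≠ 0)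
    (T : WeierstrassCurve ℚ) [T.IsElliptic] [T.IsGloballyMinimal] (C : VariableChange ℚ)
    (hC : C • T = W.quadraticTwist (NumberField.discr K : ℚ))
    (hTna : ¬ (p : ℤ) ∣ T.frobeniusTrace p - 1)
    (hTKN : ∀ v : HeightOneSpectrum (𝓞 ℚ), T.HasMultiplicativeReductionAt v → ¬ p ∣ T.ordMinimalDiscriminant v)
    [iNZT : NeZero (T.conductorNorm ℤ)] (m : ℕ) [NeZero m] (hm : IsCyclicKolyvaginLevel T p m)
    (hμ : m.primeFactors.card ≤ W.mordellWeilRank)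
    (hδT : ∀ (D : ModularParametrizationData T (T.conductorNorm ℤ)), ¬ (p : ℤ) ∣ D.maninConstant →
      (∃ u : ℚ, ‖(u : ℚ_[p])‖ = 1 ∧ T.realPeriodRat = u * plusPeriod D.f) →
      ∃ ψ : (ℓ : ℕ) → (ZMod ℓ)ˣ →* Multiplicative (ZMod p),
        (∀ ℓ ∈ m.primeFactors, Function.Surjective (ψ ℓ)) ∧ kuriharaNumber D.f p m ψ ≠ 0) :
    ∃ (p : ℕ) (hp : Fact p.Prime), 5 ≤ p ∧ W.HasGoodReductionAtPrime p ∧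
      ¬ (p : ℤ) ∣ W.frobeniusTrace p ∧ (∀ n : ℕ, W.HasSurjectiveModNGaloisRep (p ^ n : ℕ)) ∧
      (∀ v : HeightOneSpectrum (𝓞 ℚ), W.HasMultiplicativeReductionAt v →
        ¬ p ∣ W.ordMinimalDiscriminant v) ∧
      ∃ (K : Type) (_ : Field K) (_ : NumberField K), IsImaginaryQuadratic K ∧
        NumberField.discr K ≠ -3 ∧ NumberField.discr K ≠ -4 ∧
        ∃ (_ : NeZero (W.conductorNorm ℤ)), SatisfiesHeegnerHypothesis (W.conductorNorm ℤ) K ∧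
        ∃ (Dt : ModularParametrizationData W (W.conductorNorm ℤ)) (β : ℤ) (ι : K →+* ℂ) (n₁ : ℕ)
          (d : KolyvaginHeegnerData Dt β ι n₁), Squarefree n₁ ∧
          (∀ q ∈ n₁.primeFactors, Zhang2014.IsKolyvaginPrime (W.conductorNorm ℤ) W K p q) ∧
          d.kolyvaginClass hp.out 1 ≠ 0 ∧
          (n₁.primeFactors.card + 1 ≤ W.mordellWeilRank ∨
            (n₁.primeFactors.card ≤ W.mordellWeilRank ∧
              n₁.primeFactors.card + 1 ≤ (W.quadraticTwist (NumberField.discr K : ℚ)).mordellWeilRank)) := by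
  have hsur : W.HasSurjectiveModNGaloisRep p := by simpa only [pow_one] using htower 1
  have hdK : NumberField.discr K ≠ 0 := NumberField.discr_ne_zero K
  have hsha := sha_inf_torsionBy_eq_bot_of_kuriharaClaim hKim hnf hMaz W p h5 hgood hord hsur hna hKN n hn hν hδ
  have hT : Nat.card ((W.quadraticTwist (NumberField.discr K : ℚ)).selmerGroup p) ≤ p ^ W.mordellWeilRank :=
    (natCard_selmerGroup_quadraticTwist_le_of_kuriharaClaim hKim hnf hMaz W p h5 hgood hord hsur hdK hpD T C hC
      hTna hTKN m hm hδT).trans (Nat.pow_le_pow_right hp.out.pos hμ)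
  exact cruxBody_of_sha_of_twistSelmer_of_castellaSano h3 hZ hHZ hnf hMaz W hr p h5 hgood hord htower hKN K hK hodd
    hD3 hD4 hpD hspl hH hsha hT

end Summit.BirchSwinnertonDyer.BirchSwinnertonDyer.Theorems.KolyvaginDepthDoor

end
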